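import Mathlib
import HarnessLib

/-!
# Crux `TeissierResolve` (stmt-ResolutionOfSingularities-17086), line `Sketch` — stub
# `stub_gradedEtaleBaseChange`: étale base change of a diagonalizable quotient presentation

**Statement.** Let `k` be a field, `A` a finite abelian group and `S = ⨁_{a ∈ A} S_a` a smooth
finitely generated commutative `k`-algebra graded by `A` (Mathlib `GradedAlgebra 𝒮`,
`𝒮 : A → Submodule k S`), with degree-`0` part `S₀ = 𝒮 0` (a `k`-subalgebra; geometrically
`Spec S₀ = (Spec S) / D(A)` is the quotient by the diagonalizable group scheme `D(A)`). If `R` is an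
étale `S₀`-algebra (compatibly a `k`-algebra), then `R` is `k`-isomorphic to the degree-`0` part
`S'₀` of a smooth finitely generated `A`-graded commutative `k`-algebra `S'`. In the line this is the
hypothesis `hBC` of the chart-assembly step: an étale neighbourhood `Spec R → Spec S₀` of a
Bergh–Rydh chart is again a chart of the same shape.

**Proof.** Take `S' := R ⊗_{S₀} S` with the grading `S'_a := R ⊗_{S₀} S_a` (image in `S'`).
* Grading: every `S_a` is an `S₀`-submodule of `S` (`S₀ · S_a ⊆ S_{0 + a}`), so `𝒮` is a graded
  `S₀`-algebra structure `𝒜 : A → Submodule S₀ S` on `S` (same pieces); Mathlib's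
  `GradedAlgebra.baseChange` grades `R ⊗_{S₀} S` by `a ↦ (𝒜 a).baseChange R`, and restricting
  scalars to `k` keeps the grading.
* Smooth and of finite type over `k`: `S ⊗_{S₀} R` is étale over `S` (base change of the étale
  `S₀ → R`), hence smooth over `S`, hence smooth over `k` (`S` is smooth over `k`; composition);
  transport along `S ⊗_{S₀} R ≅ R ⊗_{S₀} S`; smooth includes finitely presented, so finite type.
* Degree `0`: `S'₀ = (𝒜 0).baseChange R` is the image of `R ⊗_{S₀} S₀ ≅ R`, i.e. the range of
  `r ↦ r ⊗ 1`; this map `R → S'` is injective because `R` is flat over `S₀` (étale ⇒ smooth ⇒ flat,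
  Mathlib `Algebra.Smooth.flat`) and `S₀ → S` is injective (alternatively: `S₀` is a direct summand
  of `S`). Hence `r ↦ r ⊗ 1` is a `k`-algebra isomorphism `R ≅ S'₀`.

Sources: SGA 3, Exp. VIII §§4–5 (diagonalizable group schemes ↔ gradings, invariants = degree `0`);
D. Bergh, D. Rydh, arXiv:1905.00872, Thm 5 (the charts); the commutation of invariants of
diagonalizable groups with base change is standard (e.g. Mumford, *GIT*, Ch. 1 §2, or J. Alper,
*Good moduli spaces*, Prop. 4.7). Mathlib only; no new definitions, no named facts.
-/

noncomputable section

set_option linter.dupNamespace false -- mandated namespace of this single-conjunct summit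

open TensorProduct

namespace Summit.ResolutionOfSingularities.ResolutionOfSingularities.Theorems.TeissierResolve.GradedEtaleBaseChange

/-- **Étale base change of a diagonalizable quotient presentation.** If `S` is a smooth finitely
generated commutative `k`-algebra graded by a finite abelian group `A`, with degree-`0` part
`S₀ = 𝒮 0`, and `R` is an étale `S₀`-algebra over `k`, then `R ≃ₐ[k] S'₀` for the smooth finitely
generated `A`-graded `k`-algebra `S' = R ⊗[S₀] S` graded by `a ↦ R ⊗ S_a` (Mathlib
`GradedAlgebra.baseChange`, scalars restricted to `k`): smoothness by base change of étaleness and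
composition with `k → S`, the isomorphism onto the degree-`0` part because `r ↦ r ⊗ 1` is injective
(`R` is flat over `S₀`) with range `(𝒮 0).baseChange R`. [folklore] -/
theorem stub_gradedEtaleBaseChange (k : Type) [Field k] (A : Type) [AddCommGroup A] [Finite A]
    [DecidableEq A] (S : Type) [CommRing S] [Algebra k S] (𝒮 : A → Submodule k S)
    [GradedAlgebra 𝒮] [Algebra.FiniteType k S] [Algebra.Smooth k S]
    [Algebra.FiniteType k (𝒮 0)]
    (R : Type) [CommRing R] [Algebra k R] [Algebra (𝒮 0) R] [IsScalarTower k (𝒮 0) R]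
    [Algebra.Etale (𝒮 0) R] :
    ∃ (S' : Type) (_ : CommRing S') (_ : Algebra k S') (𝒮' : A → Submodule k S')
      (_ : GradedAlgebra 𝒮'), Algebra.FiniteType k S' ∧ Algebra.Smooth k S' ∧
      Nonempty ((𝒮' 0) ≃ₐ[k] R) := by
  haveI : IsScalarTower k (𝒮 0) S := IsScalarTower.of_algebraMap_eq fun _ => rfl
  -- the same grading, as submodules over the degree-`0` subring `S₀ = 𝒮 0`
  let 𝒜 : A → Submodule (𝒮 0) S := fun a =>
    { carrier := 𝒮 a
      add_mem' := add_mem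
      zero_mem' := zero_mem _
      smul_mem' := fun c s hs => by
        have h := SetLike.mul_mem_graded (A := 𝒮) (i := 0) (j := a) c.2 hs
        rw [zero_add] at h
        exact h }
  letI i𝒜 : GradedAlgebra 𝒜 := { (‹GradedAlgebra 𝒮› : GradedAlgebra 𝒮) with }
  -- `S' := R ⊗[S₀] S`, graded by `a ↦ R ⊗ S_a` (scalars restricted from `R` to `k`)
  let 𝒮' : A → Submodule k (R ⊗[𝒮 0] S) := fun a => ((𝒜 a).baseChange R).restrictScalars k
  letI i𝒮' : GradedAlgebra 𝒮' := inferInstance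
  refine ⟨R ⊗[𝒮 0] S, inferInstance, inferInstance, 𝒮', i𝒮', ?_⟩
  -- smooth (hence of finite type) over `k`: `k → S → S ⊗[S₀] R` is smooth ∘ étale
  have e : S ⊗[𝒮 0] R ≃ₐ[k] R ⊗[𝒮 0] S :=
    (Algebra.TensorProduct.comm (𝒮 0) S R).restrictScalars k
  haveI : Algebra.Smooth k (S ⊗[𝒮 0] R) := Algebra.Smooth.comp k S (S ⊗[𝒮 0] R)
  haveI hsm : Algebra.Smooth k (R ⊗[𝒮 0] S) := Algebra.Smooth.of_equiv e
  -- the degree-`0` part is the range of `r ↦ r ⊗ 1`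
  have hrange : ∀ x ∈ (𝒜 0).baseChange R, ∃ r : R, r ⊗ₜ[𝒮 0] (1 : S) = x := by
    rintro _ ⟨y, rfl⟩
    induction y using TensorProduct.induction_on with
    | zero => exact ⟨0, by simp⟩
    | tmul r s =>
      refine ⟨(⟨(s : S), s.2⟩ : 𝒮 0) • r, ?_⟩
      rw [TensorProduct.smul_tmul]
      simp [Algebra.smul_def]
    | add y z hy hz =>
      obtain ⟨r, hr⟩ := hy
      obtain ⟨r', hr'⟩ := hz
      exact ⟨r + r', by rw [TensorProduct.add_tmul, hr, hr', map_add]⟩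
  have hinj : Function.Injective
      (Algebra.TensorProduct.includeLeft : R →ₐ[k] R ⊗[𝒮 0] S) :=
    Algebra.TensorProduct.includeLeft_injective (S := k) fun x y h => Subtype.ext h
  refine ⟨inferInstance, hsm, ⟨AlgEquiv.symm (AlgEquiv.ofBijective ?_ ?_)⟩⟩
  · exact AlgHom.codRestrict (Algebra.TensorProduct.includeLeft : R →ₐ[k] R ⊗[𝒮 0] S)
      (SetLike.GradeZero.subalgebra 𝒮')
      fun r => Submodule.tmul_mem_baseChange_of_mem r (SetLike.one_mem_graded 𝒜)
  · refine ⟨fun x y hxy => hinj (congrArg Subtype.val hxy), ?_⟩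
    rintro ⟨x, hx⟩
    obtain ⟨r, rfl⟩ := hrange x hx
    exact ⟨r, rfl⟩

end Summit.ResolutionOfSingularities.ResolutionOfSingularities.Theorems.TeissierResolve.GradedEtaleBaseChange

end
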